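import Literature.IUT.HodgeTheaters.PMBaseKitULift
import Literature.IUT.HodgeTheaters.KitNFSideEval
import Mathlib.CategoryTheory.Core
import HarnessLib

/-!
# Universe lift of the NF kit and of the §4 binders: `NFKit.ulift`, `EvalBinder.ulift`, `MultKit.ulift`

S. Mochizuki, *Inter-universal Teichmüller theory I*, kurims manuscript (May 2020), Definition 4.1 (ii)–(vi) pp. 95–97,
Example 4.3 (i)–(iii) pp. 98–100, Example 4.4 (i), (ii) pp. 105–107, Example 4.5 (i), (ii) p. 107, Definition 6.1 (v)
p. 158 ([IUTchI] Def 4.1 (v) p.97) [claim: Mochizuki2012, status: disputed] (D-0012 claim key; UNIVERSE PLUMBING for the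
cell's hypothesis structures `PMBaseKit.NFKit` (abc-iut-L5-t3, `KitNFSide.lean`), `PMBaseKit.EvalBinder` /
`MonoBinder` (`KitNFSideDatum.lean`) and `PMBaseKit.MultKit` (abc-iut-L5-t4, `PMBaseProcessions.lean`) — nothing of
the series is asserted and no side is taken on [IUTchIII] Cor. 3.12).

Companion of `PMBaseKitULift.lean` (`PMBaseKit.ulift : PMBaseKit.{u} l → PMBaseKit.{max u w} l`).  abc-iut-L5-t3's
converse dictionary `BaseThetaDatum.ofKitCore K … N B E` (universe-polymorphic) builds the §4 datum over which
abc-iut-L5-t5's `S5Local.ofDatum` is instantiated — in a SUCCESSOR universe only — from a base kit `K` together with an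
NF kit `N : K.NFKit`, a mono-analytic binder `B` and an evaluation-section binder `E`.  The closed instances of these
(abc-iut-L5-t3's `NFKit.toy`, abc-iut-L5-t17's `NFKit.thicken` / `NFKit.toyBad` / `EvalBinder.thick`, abc-iut-w5-d217's
`thickMultKit`) all live over universe-`0` kits.  This file lifts them along `PMBaseKit.ulift`:

* `PMBaseKit.locDown` / `locDownIso` — local objects (isomorphs of `𝒟_v`, Def 4.1 (i)) of the lifted kit read in `K`;
* `NFKit.ulift N : (K.ulift).NFKit` — isomorphs of `𝒟^⊚` in `AsSmall`, `φ^NF_{•,v}` / the double covering seen at `v`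
  lifted, valuations, label torsors, `[ε]`, `η_v` and the label pull-back read through `down` (all laws transfer);
* `EvalBinder.ulift E`, `MultKit.ulift M` (+ `MonoBinder` needs no lift: abc-iut-L5-t3's `MonoBinder.tautological` is
  universe-polymorphic) and the readings `polyOfLabel_ulift`, used to carry abc-iut-L5-t17's `hne`/`hrig`/`hsat`
  discharges to the lifted kit (`polyOfLabel_ulift_nonempty`, `…_rigid_of`, `thetaPolyBad_ulift_saturated_of`).

Plumbing only; every `theorem` is kernel-checked; typed ≠ proved elsewhere.
-/

namespace Literature.IUT.HodgeTheaters

open CategoryTheory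

universe u w

namespace PMBaseKit

open ULiftAux

variable {l : ℕ} (K : PMBaseKit.{u} l)

/-! ### Local objects of the lifted kit, read in `K` -/

/-- An isomorph `†𝒟_v` of the model in the lifted kit IS (the lift of) an isomorph of `𝒟_v` in `K` (Def 4.1 (i)).
([IUTchI] Def 4.1 (i) p.95) [claim: Mochizuki2012, status: disputed] -/
noncomputable def locDown {x : K.V} (X : (ulift.{u, w} K).LocalObj x) : K.LocalObj x :=
  ⟨AsSmall.down.obj X.obj, ⟨downIso X.property.some⟩⟩

/-- The model local object of the lifted kit reads as the model local object (definitional).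
([IUTchI] Def 4.1 (i) p.95) [claim: Mochizuki2012, status: disputed] -/
theorem locDown_localModel (x : K.V) : K.locDown ((ulift.{u, w} K).localModel x) = K.localModel x := rfl

/-- An isomorphism of local objects of the lifted kit read in `K`. ([IUTchI] Def 4.1 (i) p.95) [claim: Mochizuki2012, status: disputed] -/
noncomputable def locDownIso {x : K.V} {X Y : (ulift.{u, w} K).LocalObj x} (f : X ≅ Y) : K.locDown X ≅ K.locDown Y :=
  ObjectProperty.isoMk _ (downIso ((ObjectProperty.ι _).mapIso f))

/-- The underlying morphism of `locDownIso f` is the `down` of that of `f` (definitional).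
([IUTchI] Def 4.1 (i) p.95) [claim: Mochizuki2012, status: disputed] -/
theorem locDownIso_hom_hom {x : K.V} {X Y : (ulift.{u, w} K).LocalObj x} (f : X ≅ Y) :
    (K.locDownIso f).hom.hom = f.hom.hom.down := rfl

/-- `locDownIso` of the identity. ([IUTchI] Def 4.1 (i) p.95) [claim: Mochizuki2012, status: disputed] -/
theorem locDownIso_refl {x : K.V} (X : (ulift.{u, w} K).LocalObj x) : K.locDownIso (Iso.refl X) = Iso.refl _ :=
  Iso.ext rfl

/-- `locDownIso` of a composite. ([IUTchI] Def 4.1 (i) p.95) [claim: Mochizuki2012, status: disputed] -/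
theorem locDownIso_trans {x : K.V} {X Y Z : (ulift.{u, w} K).LocalObj x} (f : X ≅ Y) (g : Y ≅ Z) :
    K.locDownIso (f ≪≫ g) = K.locDownIso f ≪≫ K.locDownIso g :=
  Iso.ext rfl

/-! ### The NF kit -/

namespace NFKit

variable {K} (N : K.NFKit)

/-- **Universe lift of an NF kit.** Over the lifted base kit `K.ulift`: isomorphs of `𝒟^⊚` := `AsSmall.{w} N.GlobNF`
(Def 4.1 (v)); `†𝒟^⊚` seen at `v` := `down ⋙ N.nfAtV v ⋙ up` (Ex 4.3 (ii)); the double covering `𝒟^{⊚±} → 𝒟^⊚` seen at `v`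
and `φ^NF_{•,v}` lifted (Def 6.1 (v), Ex 4.3 (ii)(iii)); valuations `𝕍(†𝒟^⊚)`, the `𝔽_l^⋇`-torsors `LabCusp(†𝒟^⊚)`,
`LabCusp(†𝒟_v)` with `[ε]`, `η_v` and the label pull-back of Ex 4.5 READ THROUGH `down` (their types are unchanged).
Every law of abc-iut-L5-t3's structure transfers (kernel). ([IUTchI] Def 4.1 (v) p.97) [claim: Mochizuki2012, status: disputed] -/
noncomputable def ulift : (PMBaseKit.ulift.{u, w} K).NFKit where
  GlobNF := AsSmall.{w} N.GlobNF
  gnfModel := AsSmall.up.obj N.gnfModel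
  gnf_iso X Y := ⟨upIso (N.gnf_iso (AsSmall.down.obj X) (AsSmall.down.obj Y)).some⟩
  nfAtV x := AsSmall.down ⋙ N.nfAtV x ⋙ AsSmall.up
  projAt x := ULift.up (N.projAt x)
  phiNF x := ULift.up (N.phiNF x)
  phiNF_eq x := congrArg ULift.up (N.phiNF_eq x)
  Val Y := N.Val (AsSmall.down.obj Y)
  valIso φ := N.valIso (downIso φ)
  valIso_refl X := by
    rw [downIso_refl]
    exact N.valIso_refl _
  valIso_trans f g := by
    rw [downIso_trans]
    exact N.valIso_trans _ _
  valOfV := N.valOfV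
  GLabNF Y := N.GLabNF (AsSmall.down.obj Y)
  isTorsor_gLabNF Y := N.isTorsor_gLabNF _
  gLabNFMap φ := N.gLabNFMap (downIso φ)
  gLabNFMap_smul b j c := N.gLabNFMap_smul _ j c
  gLabNFMap_refl Y := by
    rw [downIso_refl]
    exact N.gLabNFMap_refl _
  gLabNFMap_trans b b' := by
    rw [downIso_trans]
    exact N.gLabNFMap_trans _ _
  εLab := N.εLab
  exists_aut_smul j := by
    obtain ⟨b, hb⟩ := N.exists_aut_smul j
    let Y₀ : AsSmall.{w} N.GlobNF := AsSmall.up.obj N.gnfModel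
    refine ⟨upIso (X := Y₀) (Y := Y₀) b, fun c => ?_⟩
    show N.gLabNFMap (downIso (upIso (X := Y₀) (Y := Y₀) b)) c = j • c
    rw [downIso_upIso]
    exact hb c
  LabStar x X := N.LabStar x (K.locDown X)
  isTorsor_labStar x X := N.isTorsor_labStar x _
  labStarIso f := N.labStarIso (K.locDownIso f)
  labStarIso_smul f j c := N.labStarIso_smul _ j c
  labStarIso_refl X := by
    rw [locDownIso_refl]
    exact N.labStarIso_refl _
  labStarIso_trans f g := by
    rw [locDownIso_trans]
    exact N.labStarIso_trans _ _
  ηStar x X := N.ηStar x (K.locDown X)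
  labStarIso_η f := N.labStarIso_η _
  labPull {x} {X} {Y} f := N.labPull (X := K.locDown X) (Y := AsSmall.down.obj Y) f.down
  labPull_smul f j c := N.labPull_smul _ j c
  labPull_pre := fun {x} {X} {X'} {Y} a f c => N.labPull_pre (X := K.locDown X) (X' := K.locDown X')
    (Y := AsSmall.down.obj Y) (K.locDownIso a) f.down c
  labPull_post := fun {x} {X} {Y} {Y'} f b c => N.labPull_post (X := K.locDown X) (Y := AsSmall.down.obj Y)
    (Y' := AsSmall.down.obj Y') f.down (downIso b) c
  labPull_phiNF_εLab x := N.labPull_phiNF_εLab x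

/-- The model global object of the lifted NF kit is `⟨𝒟^⊚⟩`. ([IUTchI] Def 4.1 (v) p.97) [claim: Mochizuki2012, status: disputed] -/
theorem ulift_gnfModel : (ulift.{u, w} N).gnfModel = AsSmall.up.obj N.gnfModel := rfl

/-- `φ^NF_{•,v}` of the lifted NF kit is the lift of `φ^NF_{•,v}`. ([IUTchI] Ex 4.3 (ii) p.99) [claim: Mochizuki2012, status: disputed] -/
theorem ulift_phiNF_down (x : K.V) : ((ulift.{u, w} N).phiNF x).down = N.phiNF x := rfl

/-- The chosen cusp class `[ε]` of the lifted NF kit is that of `N`. ([IUTchI] Ex 4.5 (ii) p.107) [claim: Mochizuki2012, status: disputed] -/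
theorem ulift_εLab : (ulift.{u, w} N).εLab = N.εLab := rfl

/-- **KIT-RULE transfer** for NF kits. ([IUTchI] Def 4.1 (v) p.97) [claim: Mochizuki2012, status: disputed] -/
theorem nonempty_ulift (h : Nonempty K.NFKit) : Nonempty (PMBaseKit.ulift.{u, w} K).NFKit := ⟨ulift.{u, w} h.some⟩

end NFKit

/-! ### The evaluation-section binder -/

namespace EvalBinder

variable {K} (E : K.EvalBinder)

/-- **Universe lift of an evaluation-section binder** (Ex 4.4 (i), (ii)): a morphism between local objects of the
lifted kit "arises from an evaluation section labelled `j`" iff its `down` does; closure under iso-composition,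
occurrence of every label and rigidity transfer. ([IUTchI] Ex 4.4 (i) p.105) [claim: Mochizuki2012, status: disputed] -/
def ulift : (PMBaseKit.ulift.{u, w} K).EvalBinder where
  IsEvalSection hx j X Y f := E.IsEvalSection hx j (X := K.locDown X) (Y := K.locDown Y) f.down
  isoComp := fun {x} hx j {X X' Y} a f h => E.isoComp hx j (X := K.locDown X) (X' := K.locDown X')
    (Y := K.locDown Y) (K.locDownIso a) f.down h
  compIso := fun {x} hx j {X Y Y'} f b h => E.compIso hx j (X := K.locDown X) (Y := K.locDown Y)
    (Y' := K.locDown Y') f.down (K.locDownIso b) h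
  exists_section hx j X Y := by
    obtain ⟨f, hf⟩ := E.exists_section hx j (K.locDown X) (K.locDown Y)
    exact ⟨ULift.up f, hf⟩
  label_unique := fun {x} hx {j j'} {X Y} f h h' => E.label_unique hx (X := K.locDown X) (Y := K.locDown Y) f.down h h'

/-- The lifted binder's predicate, unfolded (definitional). ([IUTchI] Ex 4.4 (i) p.105) [claim: Mochizuki2012, status: disputed] -/
theorem isEvalSection_ulift_iff {x : K.V} (hx : x ∈ K.bad) (j : FlAbs l) {X Y : (PMBaseKit.ulift.{u, w} K).LocalObj x}
    (f : X.obj ⟶ Y.obj) :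
    (ulift.{u, w} E).IsEvalSection hx j f ↔ E.IsEvalSection hx j (X := K.locDown X) (Y := K.locDown Y) f.down :=
  Iff.rfl

/-- **KIT-RULE transfer** for evaluation-section binders. ([IUTchI] Ex 4.4 (i) p.105) [claim: Mochizuki2012, status: disputed] -/
theorem nonempty_ulift (h : Nonempty K.EvalBinder) : Nonempty (PMBaseKit.ulift.{u, w} K).EvalBinder :=
  ⟨ulift.{u, w} h.some⟩

end EvalBinder

/-! ### `𝒟`-prime-strips of the lifted kit and the multiplicative kit -/

namespace DStrip

variable {K}

/-- A `𝒟`-prime-strip of the lifted kit read in `K` (componentwise `down`). ([IUTchI] Def 4.1 (i) p.95) [claim: Mochizuki2012, status: disputed] -/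
noncomputable def down (D : (PMBaseKit.ulift.{u, w} K).DStrip) : K.DStrip :=
  ⟨fun v => AsSmall.down.obj (D.obj v), fun v => ⟨downIso (D.isLocal v).some⟩⟩

/-- An isomorphism of `𝒟`-prime-strips of the lifted kit read in `K`. ([IUTchI] Def 4.1 (iv) p.96) [claim: Mochizuki2012, status: disputed] -/
def Iso.down {D₁ D₂ : (PMBaseKit.ulift.{u, w} K).DStrip} (φ : D₁.Iso D₂) : (DStrip.down D₁).Iso (DStrip.down D₂) :=
  fun v => downIso (φ v)

end DStrip

namespace MultKit

variable {K} (M : K.MultKit)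

/-- **Universe lift of a multiplicative kit** (Def 4.1 (iii)(iv), Ex 4.4): `𝒟^⊢`-prime-strips := the core groupoid of
the small model `AsSmall.{w} M.DMono` (same isomorphism classes), mono-analyticisation read through `down`, and the
model poly-morphisms `φ^Θ_{v_j}` at bad places := the morphisms of the lifted model whose `down` lies in `M`'s.
([IUTchI] Def 4.1 (iv) p.96) [claim: Mochizuki2012, status: disputed] -/
noncomputable def ulift : (PMBaseKit.ulift.{u, w} K).MultKit where
  DMono := Core (AsSmall.{w} M.DMono)
  mono D := ⟨AsSmall.up.obj (M.mono (DStrip.down D))⟩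
  monoMap φ := CoreHom.mk (upIso (Groupoid.isoEquivHom _ _ |>.symm (M.monoMap (DStrip.Iso.down φ))))
  thetaPolyBad j x hx := {g | g.down ∈ M.thetaPolyBad j x hx}

/-- The model `φ^Θ_{v_j}` of the lifted multiplicative kit, unfolded (definitional). ([IUTchI] Ex 4.4 (i) p.105) [claim: Mochizuki2012, status: disputed] -/
theorem mem_thetaPolyBad_ulift_iff (j : Fin ((l - 1) / 2)) (x : K.V) (hx : x ∈ K.bad)
    (g : (PMBaseKit.ulift.{u, w} K).model x ⟶ (PMBaseKit.ulift.{u, w} K).model x) :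
    g ∈ (ulift.{u, w} M).thetaPolyBad j x hx ↔ g.down ∈ M.thetaPolyBad j x hx :=
  Iff.rfl

/-- Transfer of abc-iut-L5-t3's input `hsat` (bi-saturation of `φ^Θ_{v_j}` under automorphisms of `𝒟_v`) to the lifted
kit. ([IUTchI] Ex 4.4 (ii) p.107) [claim: Mochizuki2012, status: disputed] -/
theorem thetaPolyBad_ulift_saturated_of
    (hsat : ∀ x (hx : x ∈ K.bad) (j : Fin (lStar l)) (θ β : K.model x ≅ K.model x) {g : K.model x ⟶ K.model x},
      g ∈ M.thetaPolyBad j x hx → θ.hom ≫ g ≫ β.hom ∈ M.thetaPolyBad j x hx)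
    (x : K.V) (hx : x ∈ (PMBaseKit.ulift.{u, w} K).bad) (j : Fin (lStar l))
    (θ β : (PMBaseKit.ulift.{u, w} K).model x ≅ (PMBaseKit.ulift.{u, w} K).model x)
    {g : (PMBaseKit.ulift.{u, w} K).model x ⟶ (PMBaseKit.ulift.{u, w} K).model x}
    (hg : g ∈ (ulift.{u, w} M).thetaPolyBad j x hx) : θ.hom ≫ g ≫ β.hom ∈ (ulift.{u, w} M).thetaPolyBad j x hx :=
  hsat x hx j (downIso θ) (downIso β) hg

variable [Fact l.Prime] (hl5 : 5 ≤ l) (Z : ∀ x : K.V, x ∈ K.bad → Set (K.model x ⟶ K.model x))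

/-- The zero-labelled class supplied to `polyOfLabel`, lifted: morphisms whose `down` lies in `Z v`.
([IUTchI] Ex 4.4 (i) p.105) [claim: Mochizuki2012, status: disputed] -/
def zeroUp : ∀ x : K.V, x ∈ (PMBaseKit.ulift.{u, w} K).bad →
    Set ((PMBaseKit.ulift.{u, w} K).model x ⟶ (PMBaseKit.ulift.{u, w} K).model x) :=
  fun x hx => {g | g.down ∈ Z x hx}

/-- **`polyOfLabel` of the lifted kit** = the morphisms whose `down` lies in `polyOfLabel` of `M` (label by label, the
zero label included). ([IUTchI] Ex 4.4 (i) p.105) [claim: Mochizuki2012, status: disputed] -/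
theorem mem_polyOfLabel_ulift_iff (x : K.V) (hx : x ∈ K.bad) (j : FlAbs l)
    (g : (PMBaseKit.ulift.{u, w} K).model x ⟶ (PMBaseKit.ulift.{u, w} K).model x) :
    g ∈ (ulift.{u, w} M).polyOfLabel hl5 (zeroUp Z) x hx j ↔ g.down ∈ M.polyOfLabel hl5 Z x hx j := by
  unfold polyOfLabel
  cases flAbsEquivOption l j <;> rfl

/-- Transfer of abc-iut-L5-t3's input `hne` (every class nonempty) to the lifted kit. ([IUTchI] Ex 4.4 (i) p.105) [claim: Mochizuki2012, status: disputed] -/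
theorem polyOfLabel_ulift_nonempty (hne : ∀ x (hx : x ∈ K.bad) j, (M.polyOfLabel hl5 Z x hx j).Nonempty)
    (x : K.V) (hx : x ∈ (PMBaseKit.ulift.{u, w} K).bad) (j : FlAbs l) :
    ((ulift.{u, w} M).polyOfLabel hl5 (zeroUp Z) x hx j).Nonempty := by
  obtain ⟨g, hg⟩ := hne x hx j
  exact ⟨ULift.up g, (mem_polyOfLabel_ulift_iff M hl5 Z x hx j _).mpr hg⟩

/-- Transfer of abc-iut-L5-t3's input `hrig` (labels rigid under iso-conjugation) to the lifted kit.
([IUTchI] Ex 4.4 (ii) p.107) [claim: Mochizuki2012, status: disputed] -/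
theorem polyOfLabel_ulift_rigid_of
    (hrig : ∀ x (hx : x ∈ K.bad) {j j' : FlAbs l} {g g' : K.model x ⟶ K.model x} (θ β : K.model x ≅ K.model x),
      g ∈ M.polyOfLabel hl5 Z x hx j → g' ∈ M.polyOfLabel hl5 Z x hx j' → g' = θ.hom ≫ g ≫ β.hom → j = j')
    (x : K.V) (hx : x ∈ (PMBaseKit.ulift.{u, w} K).bad) {j j' : FlAbs l}
    {g g' : (PMBaseKit.ulift.{u, w} K).model x ⟶ (PMBaseKit.ulift.{u, w} K).model x}
    (θ β : (PMBaseKit.ulift.{u, w} K).model x ≅ (PMBaseKit.ulift.{u, w} K).model x)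
    (hg : g ∈ (ulift.{u, w} M).polyOfLabel hl5 (zeroUp Z) x hx j)
    (hg' : g' ∈ (ulift.{u, w} M).polyOfLabel hl5 (zeroUp Z) x hx j') (h : g' = θ.hom ≫ g ≫ β.hom) : j = j' :=
  hrig x hx (downIso θ) (downIso β) ((mem_polyOfLabel_ulift_iff M hl5 Z x hx j g).mp hg)
    ((mem_polyOfLabel_ulift_iff M hl5 Z x hx j' g').mp hg') (congrArg ULift.down h)

end MultKit

end PMBaseKit

end Literature.IUT.HodgeTheaters
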